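import Mathlib
import Summits.Ventures.HodgeRepro2.T5DoubleCosetDecomposition

/-!
# T5BallQuotientDecomposition — «`Sh_K(ℂ) = ⊔_j Γ_j \ 𝔹²`» as sets (archimedean-level version)

Kernel annex of the blind cell `pub-hodge-repro2`, seat p2, Tier-5 sub-step N1 (route/T5-ID-p2.md,
§ID-4(b′)); companion of `T5DoubleCosetDecomposition` (p391635), which treats the level `{1} × K`.

Here the level is `K_∞ × K` with `K_∞ ≤ A` (= the maximal compact `K_∞ ≤ G_∞`, so that
`A / K_∞ = 𝔹²`).  Three statements, all purely group-theoretic: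

1. `decompositionDC`: `Σ (q : H_B \ B / K), Γ_{g_q} \ A / K_∞  ≃  H \ (A × B) / (K_∞ × K)`
   (both sides Mathlib `DoubleCoset.Quotient`; `Γ_g = gammaGroup H K g` of the companion file;
   `K_∞ = ⊥` is the companion's statement).
2. `doubleCosetEquivOrbitSpace`: for `Γ, K_∞ ≤ G`, `Γ \ G / K_∞ ≃ orbitRel.Quotient Γ (G ⧸ K_∞)` —
   the double-coset space is the orbit space of `Γ` acting on the left cosets (`Γ \ 𝔹²`).
3. `ballDecomposition`: the composite `Σ q, orbitRel.Quotient Γ_{g_q} (A ⧸ K_∞) ≃ H \ (A × B) / (K_∞ × K)`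
   — «the complex points of the level-`K` Shimura variety are the disjoint union of the
   arithmetic quotients `Γ_j \ 𝔹²`», at the level of sets.

What stays prose: the complex structure of `𝔹² = G_∞ / K_∞`, the finiteness of the index set
(adelic), the descent of differential forms (B1/B2; the integrals are handled abstractly in
`T5IntegralBookkeeping`).
-/

namespace Summit.Ventures.HodgeRepro2.T5BallQuotientDecomposition

open Summit.Ventures.HodgeRepro2.T5DoubleCosetDecomposition

universe u v

variable {A : Type u} {B : Type v} [Group A] [Group B]

/-! ### 1. The decomposition with archimedean level `K_∞ × K` -/

/-- The level subgroup `K_∞ × K` of `A × B`. -/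
def levelProd (Kinf : Subgroup A) (K : Subgroup B) : Subgroup (A × B) :=
  Kinf.prod K

/-- Membership in `K_∞ × K`. -/
theorem mem_levelProd {Kinf : Subgroup A} {K : Subgroup B} {p : A × B} :
    p ∈ levelProd Kinf K ↔ p.1 ∈ Kinf ∧ p.2 ∈ K :=
  Subgroup.mem_prod

/-- The full double-coset space `H \ (A × B) / (K_∞ × K)`. -/
abbrev FullQuotientDC (H : Subgroup (A × B)) (Kinf : Subgroup A) (K : Subgroup B) : Type _ :=
  DoubleCoset.Quotient (H : Set (A × B)) (levelProd Kinf K : Set (A × B))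

/-- The component `Γ_{g_q} \ A / K_∞` attached to a finite double coset `q`. -/
abbrev ComponentDC (H : Subgroup (A × B)) (Kinf : Subgroup A) (K : Subgroup B)
    (q : FiniteQuotient H K) : Type _ :=
  DoubleCoset.Quotient (gammaGroup H K (rep q) : Set A) (Kinf : Set A)

/-- Two points of `A` in the same `(Γ_g, K_∞)`-double coset define the same
`(H, K_∞ × K)`-double coset of `(·, g)`. -/
theorem mk_eq_mk_of_rel {H : Subgroup (A × B)} {Kinf : Subgroup A} {K : Subgroup B} {g : B}
    {a a' : A} (hrel : DoubleCoset.setoid (gammaGroup H K g : Set A) (Kinf : Set A) a a') :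
    DoubleCoset.mk H (levelProd Kinf K) (a, g) = DoubleCoset.mk H (levelProd Kinf K) (a', g) := by
  obtain ⟨γ, hγ, kinf, hkinf, rfl⟩ := DoubleCoset.rel_iff.1 hrel
  obtain ⟨h, hH, rfl, k, hk, hh2⟩ := mem_gammaGroup.1 hγ
  rw [DoubleCoset.eq]
  refine ⟨h, hH, (kinf, k⁻¹), mem_levelProd.2 ⟨hkinf, K.inv_mem hk⟩, ?_⟩
  ext
  · simp only [Prod.fst_mul]
  · simp only [Prod.snd_mul, hh2]
    group

/-- The map `Γ_q \ A / K_∞ → H \ (A × B) / (K_∞ × K)`, `Γ_q a K_∞ ↦ H (a, g_q) (K_∞ × K)`. -/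
noncomputable def toFullDC {H : Subgroup (A × B)} {Kinf : Subgroup A} {K : Subgroup B}
    (q : FiniteQuotient H K) (x : ComponentDC H Kinf K q) : FullQuotientDC H Kinf K :=
  Quotient.liftOn' x (fun a => DoubleCoset.mk H (levelProd Kinf K) (a, rep q))
    (fun _ _ hrel => mk_eq_mk_of_rel hrel)

/-- `toFullDC` on a representative. -/
@[simp]
theorem toFullDC_mk {H : Subgroup (A × B)} {Kinf : Subgroup A} {K : Subgroup B}
    (q : FiniteQuotient H K) (a : A) :
    toFullDC q (DoubleCoset.mk (gammaGroup H K (rep q)) Kinf a) =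
      DoubleCoset.mk H (levelProd Kinf K) (a, rep q) :=
  rfl

/-- The finite part of an `(H, K_∞ × K)`-double coset: `H (a, b) (K_∞ × K) ↦ H_B b K`. -/
def finitePartDC {H : Subgroup (A × B)} {Kinf : Subgroup A} {K : Subgroup B}
    (t : FullQuotientDC H Kinf K) : FiniteQuotient H K :=
  Quotient.liftOn' t (fun p => DoubleCoset.mk (imageSnd H) K p.2) (by
    intro p p' hpp'
    obtain ⟨h, hH, k, hk, rfl⟩ := DoubleCoset.rel_iff.1 hpp'
    rw [DoubleCoset.eq]
    exact ⟨h.2, ⟨h, hH, rfl⟩, k.2, (mem_levelProd.1 hk).2, rfl⟩)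

/-- `finitePartDC` on a representative. -/
@[simp]
theorem finitePartDC_mk {H : Subgroup (A × B)} {Kinf : Subgroup A} {K : Subgroup B} (p : A × B) :
    finitePartDC (DoubleCoset.mk H (levelProd Kinf K) p) = DoubleCoset.mk (imageSnd H) K p.2 :=
  rfl

/-- The components are fibred over the finite double-coset space. -/
theorem finitePartDC_toFullDC {H : Subgroup (A × B)} {Kinf : Subgroup A} {K : Subgroup B}
    (q : FiniteQuotient H K) (x : ComponentDC H Kinf K q) : finitePartDC (toFullDC q x) = q := by
  induction x using Quotient.inductionOn' with
  | h a => simp [mk_rep]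

/-- Injectivity of the assembled map `Σ q, Γ_q \ A / K_∞ → H \ (A × B) / (K_∞ × K)`. -/
theorem toFullDC_injective {H : Subgroup (A × B)} {Kinf : Subgroup A} {K : Subgroup B} :
    Function.Injective
      (fun p : Σ q : FiniteQuotient H K, ComponentDC H Kinf K q => toFullDC p.1 p.2) := by
  rintro ⟨q, x⟩ ⟨q', x'⟩ hxx'
  have hq : q = q' := by
    have := congrArg finitePartDC hxx'
    simpa only [finitePartDC_toFullDC] using this
  subst hq
  induction x using Quotient.inductionOn' with
  | h a =>
    induction x' using Quotient.inductionOn' with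
    | h a' =>
      obtain ⟨h, hH, k, hk, hprod⟩ := (DoubleCoset.eq _ _ _ _).1 hxx'
      obtain ⟨hk1, hk2⟩ := mem_levelProd.1 hk
      have h1 : a' = h.1 * a * k.1 := by
        have := congrArg Prod.fst hprod
        simpa only [Prod.fst_mul] using this
      have h2 : h.2 = rep q * k.2⁻¹ * (rep q)⁻¹ := by
        have hsnd : rep q = h.2 * rep q * k.2 := by
          have := congrArg Prod.snd hprod
          simpa only [Prod.snd_mul] using this
        calc h.2 = (h.2 * rep q * k.2) * k.2⁻¹ * (rep q)⁻¹ := by group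
          _ = rep q * k.2⁻¹ * (rep q)⁻¹ := by rw [← hsnd]
      congr 1
      apply Quotient.sound'
      rw [DoubleCoset.rel_iff]
      exact ⟨h.1, ⟨h, hH, rfl, k.2⁻¹, K.inv_mem hk2, h2⟩, k.1, hk1, h1⟩

/-- Surjectivity of the assembled map. -/
theorem toFullDC_surjective {H : Subgroup (A × B)} {Kinf : Subgroup A} {K : Subgroup B} :
    Function.Surjective
      (fun p : Σ q : FiniteQuotient H K, ComponentDC H Kinf K q => toFullDC p.1 p.2) := by
  intro t
  induction t using Quotient.inductionOn' with
  | h p =>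
    obtain ⟨a, b⟩ := p
    set q : FiniteQuotient H K := DoubleCoset.mk (imageSnd H) K b with hq
    obtain ⟨hb, k, hhb, hk, hout⟩ := DoubleCoset.mk_out_eq_mul (imageSnd H) K b
    obtain ⟨h, hH, rfl⟩ := mem_imageSnd.1 hhb
    refine ⟨⟨q, DoubleCoset.mk _ _ (h.1 * a)⟩, ?_⟩
    show DoubleCoset.mk H (levelProd Kinf K) (h.1 * a, rep q) =
      DoubleCoset.mk H (levelProd Kinf K) (a, b)
    symm
    rw [DoubleCoset.eq]
    refine ⟨h, hH, (1, k), mem_levelProd.2 ⟨Kinf.one_mem, hk⟩, ?_⟩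
    ext
    · simp
    · simp only [Prod.snd_mul]
      exact hout

/-- THE DECOMPOSITION WITH ARCHIMEDEAN LEVEL:
`Σ (q : H_B \ B / K), Γ_{g_q} \ A / K_∞  ≃  H \ (A × B) / (K_∞ × K)`. -/
noncomputable def decompositionDC (H : Subgroup (A × B)) (Kinf : Subgroup A) (K : Subgroup B) :
    (Σ q : FiniteQuotient H K, ComponentDC H Kinf K q) ≃ FullQuotientDC H Kinf K :=
  Equiv.ofBijective _ ⟨toFullDC_injective, toFullDC_surjective⟩

/-- The decomposition is the assembled map `⟨q, x⟩ ↦ toFullDC q x`. -/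
@[simp]
theorem decompositionDC_apply {H : Subgroup (A × B)} {Kinf : Subgroup A} {K : Subgroup B}
    (p : Σ q : FiniteQuotient H K, ComponentDC H Kinf K q) :
    decompositionDC H Kinf K p = toFullDC p.1 p.2 :=
  rfl

/-- The index of a double coset under the inverse decomposition is its finite part. -/
theorem fst_symm_decompositionDC {H : Subgroup (A × B)} {Kinf : Subgroup A} {K : Subgroup B}
    (t : FullQuotientDC H Kinf K) :
    ((decompositionDC H Kinf K).symm t).1 = finitePartDC t := by
  conv_rhs => rw [← (decompositionDC H Kinf K).apply_symm_apply t]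
  rw [decompositionDC_apply, finitePartDC_toFullDC]

/-! ### 2. `Γ \ G / K_∞` is the orbit space of `Γ` on `G ⧸ K_∞` -/

section OrbitSpace

variable {G : Type u} [Group G]

/-- The double-coset relation `Γ g K = Γ g' K` is the orbit relation of `Γ` acting on the left
cosets `G ⧸ K`. -/
theorem rel_iff_orbitRel (Γ K : Subgroup G) (g g' : G) :
    DoubleCoset.setoid (Γ : Set G) (K : Set G) g g' ↔
      MulAction.orbitRel Γ (G ⧸ K) (g : G ⧸ K) (g' : G ⧸ K) := by
  rw [DoubleCoset.rel_iff, MulAction.orbitRel_apply, MulAction.mem_orbit_iff]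
  constructor
  · rintro ⟨γ, hγ, k, hk, rfl⟩
    refine ⟨⟨γ⁻¹, Γ.inv_mem hγ⟩, ?_⟩
    show ((γ⁻¹ * (γ * g * k) : G) : G ⧸ K) = (g : G ⧸ K)
    rw [QuotientGroup.eq]
    have : (γ⁻¹ * (γ * g * k))⁻¹ * g = k⁻¹ := by group
    rw [this]
    exact K.inv_mem hk
  · rintro ⟨⟨γ, hγ⟩, hγg⟩
    have hγg' : ((γ * g' : G) : G ⧸ K) = (g : G ⧸ K) := hγg
    rw [QuotientGroup.eq] at hγg'
    refine ⟨γ⁻¹, Γ.inv_mem hγ, ((γ * g')⁻¹ * g)⁻¹, K.inv_mem hγg', ?_⟩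
    group

/-- The map `Γ \ G / K → Γ \ (G ⧸ K)`, `Γ g K ↦ Γ · (g K)`. -/
def toOrbitSpace (Γ K : Subgroup G) (t : DoubleCoset.Quotient (Γ : Set G) (K : Set G)) :
    MulAction.orbitRel.Quotient Γ (G ⧸ K) :=
  Quotient.liftOn' t (fun g => Quotient.mk'' (g : G ⧸ K))
    (fun g g' h => Quotient.sound' ((rel_iff_orbitRel Γ K g g').1 h))

/-- `toOrbitSpace` on a representative. -/
@[simp]
theorem toOrbitSpace_mk (Γ K : Subgroup G) (g : G) :
    toOrbitSpace Γ K (DoubleCoset.mk Γ K g) = Quotient.mk'' (g : G ⧸ K) :=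
  rfl

/-- `toOrbitSpace` is injective. -/
theorem toOrbitSpace_injective (Γ K : Subgroup G) : Function.Injective (toOrbitSpace Γ K) := by
  intro t t' h
  induction t using Quotient.inductionOn' with
  | h g =>
    induction t' using Quotient.inductionOn' with
    | h g' =>
      apply Quotient.sound'
      exact (rel_iff_orbitRel Γ K g g').2 (Quotient.exact' h)

/-- `toOrbitSpace` is surjective. -/
theorem toOrbitSpace_surjective (Γ K : Subgroup G) : Function.Surjective (toOrbitSpace Γ K) := by
  intro x
  induction x using Quotient.inductionOn' with
  | h c =>
    induction c using QuotientGroup.induction_on with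
    | H g => exact ⟨DoubleCoset.mk Γ K g, rfl⟩

/-- `Γ \ G / K ≃ Γ \ (G ⧸ K)`: the double-coset space is the orbit space of `Γ` on the left
cosets — for `G = G_∞`, `K = K_∞`: `Γ \ G_∞ / K_∞ = Γ \ 𝔹²` as sets. -/
noncomputable def doubleCosetEquivOrbitSpace (Γ K : Subgroup G) :
    DoubleCoset.Quotient (Γ : Set G) (K : Set G) ≃ MulAction.orbitRel.Quotient Γ (G ⧸ K) :=
  Equiv.ofBijective _ ⟨toOrbitSpace_injective Γ K, toOrbitSpace_surjective Γ K⟩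

/-- The orbit-space equivalence on a representative. -/
@[simp]
theorem doubleCosetEquivOrbitSpace_mk (Γ K : Subgroup G) (g : G) :
    doubleCosetEquivOrbitSpace Γ K (DoubleCoset.mk Γ K g) = Quotient.mk'' (g : G ⧸ K) :=
  rfl

end OrbitSpace

/-! ### 3. The composite: «`Sh_K(ℂ) = ⊔_j Γ_j \ 𝔹²`» -/

/-- «THE COMPLEX POINTS ARE A DISJOINT UNION OF BALL QUOTIENTS» (as sets):
`Σ (q : H_B \ B / K), Γ_{g_q} \ (A ⧸ K_∞)  ≃  H \ (A × B) / (K_∞ × K)`, where `Γ_{g_q} \ (A ⧸ K_∞)`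
is the orbit space of the arithmetic group `Γ_{g_q} = {h_A : h ∈ H, h_B ∈ g_q K g_q⁻¹}` acting on
the left cosets `A ⧸ K_∞` (= `𝔹²` for `A = G_∞`, `K_∞` maximal compact). -/
noncomputable def ballDecomposition (H : Subgroup (A × B)) (Kinf : Subgroup A) (K : Subgroup B) :
    (Σ q : FiniteQuotient H K, MulAction.orbitRel.Quotient (gammaGroup H K (rep q)) (A ⧸ Kinf)) ≃
      FullQuotientDC H Kinf K :=
  (Equiv.sigmaCongrRight fun q => (doubleCosetEquivOrbitSpace (gammaGroup H K (rep q)) Kinf).symm).trans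
    (decompositionDC H Kinf K)

/-- `ballDecomposition` on a representative: the orbit of `a K_∞` in the `q`-th component goes to
`H (a, g_q) (K_∞ × K)`. -/
theorem ballDecomposition_mk {H : Subgroup (A × B)} {Kinf : Subgroup A} {K : Subgroup B}
    (q : FiniteQuotient H K) (a : A) :
    ballDecomposition H Kinf K ⟨q, Quotient.mk'' (a : A ⧸ Kinf)⟩ =
      DoubleCoset.mk H (levelProd Kinf K) (a, rep q) := by
  have h : (doubleCosetEquivOrbitSpace (gammaGroup H K (rep q)) Kinf).symm
      (Quotient.mk'' (a : A ⧸ Kinf)) = DoubleCoset.mk (gammaGroup H K (rep q)) Kinf a := by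
    rw [Equiv.symm_apply_eq, doubleCosetEquivOrbitSpace_mk]
  simp only [ballDecomposition, Equiv.trans_apply, Equiv.sigmaCongrRight_apply, h,
    decompositionDC_apply, toFullDC_mk]

/-- Finitely many finite double cosets ⇒ finitely many ball-quotient components. -/
theorem finite_components {H : Subgroup (A × B)} {Kinf : Subgroup A} {K : Subgroup B}
    [Finite (FiniteQuotient H K)] :
    ∃ (ι : Type v) (_ : Finite ι) (Γ : ι → Subgroup A),
      Nonempty (FullQuotientDC H Kinf K ≃ Σ i : ι, MulAction.orbitRel.Quotient (Γ i) (A ⧸ Kinf)) :=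
  ⟨FiniteQuotient H K, inferInstance, fun q => gammaGroup H K (rep q),
    ⟨(ballDecomposition H Kinf K).symm⟩⟩

end Summit.Ventures.HodgeRepro2.T5BallQuotientDecomposition
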